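import Summits.MatrixMultiplication.MatrixMultiplication.Theorems.EdgePencilSixPairs
import HarnessLib

/-!
# THE SIX-EDGE CALIBRATION: `TROP(n,2) ⟹ ω(K₄) ≤ max(ψ, 24/(5 + log_n 2))` — one base of tropical domination
# either closes the leaf `ω(K₄) ≤ ψ` or caps the tetrahedron exponent strictly below `4.8`

Support kernel for `stmt-MatrixMultiplication-26697` (`TetraExcessZero : ω(K₄) ≤ ω(2,1,2) =: ψ`, route
`TetrahedronCarving`; cut of record `closes (TetraExcessZero) (TetraPlusTwo) : ω = 2`, UNCHANGED; lineage
`decomp-mm-lens-6`, generation 44; the CALIBRATION KERNEL named by the writer, RECORD R43.5). No item is added or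
changed; no definition is introduced. `TROP(n,e)` is the tree's hypothesis of `EdgePencilTropicalPair.sixRung_of_trop`:
`∀ φ ∈ X₄(F), φ[W_n^{(e)}] ≤ max (φ[D_n]) n⁴`.

THE ARGUMENT (§30). Let `δ = log_n 2 ∈ (0,1)` (`n ≥ 3`), `ω = ω(K₄)`, and suppose `ω > ψ`. Take a
`T(K₄)`-maximal point `φ` at base `n` (`φ[T(K₄)_n] = n^ω`, `EdgePencilBlindMaximal`). For each of the six edges
`vw` transport `φ` to `φ' = φ^{σ_vw} ∈ X₄(F)` (`EdgePencilSixPairs.exists_transport_pair`): `φ'` is again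
`T(K₄)`-maximal and its pair-rate is `p' = p^{vw}_φ`, its diamond-rate `d' = ω − p'` (`τ = p + d`,
`EdgePencilExponentConstancy`). `TROP(n,2)` at `φ'` says: `φ'` is blind at thickness `2` — then `p' = 0`, `φ'` is
blind at thickness `n`, i.e. a `T(K₄)`-maximal `01`-blind point, and the leaf holds
(`EdgePencilBlindMaximal.excessZero_iff_exists_blind_maximal`), contradiction — or `2^{p'} n^{ω−p'} ≤ n⁴`, i.e.
`p^{vw}_φ ≥ (ω − 4)/(1 − δ)` (`pairRateAt_ge_of_trop_two`). Summing over the six edges with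
`Σ_{vw} p^{vw}_φ = τ_φ = ω` (`EdgePencilSixPairs.logb_spectrum_tetra_two_eq_sum_pairs`):
`ω ≥ 6(ω − 4)/(1 − δ)`, i.e. `ω ≤ 24/(5 + δ)` (`omegaTetra_le_max_of_trop_two`). Over `ℂ`
(`tetraExcessZero_or_omegaTetra_le_of_trop_two`): `TROP(n,2) ⟹ TetraExcessZero ∨ ω(K₄) ≤ 24/(5 + log_n 2)`
(`n = 3`: `4.2619…`; `n = 4`: `4.3636…`; `n → ∞`: `4.8`), to be read against the printed `ω(K₄) ≤ 4.6377`
(CVZ19 §1.2, not a tree fact) and the tree's `4 ≤ ω(K₄)`: at small bases `TROP(n,2)` without the leaf would be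
a NEW upper bound on `ω(K₄)`; the honest price of the one-switch tropical law is this cap, not the leaf.

References: Christandl–Vrana–Zuiddam 2019, §1.2 (the `K₄` exponent, `τ(T(K₄)) = ω(K₄)/6`) [ChristandlVranaZuiddam2016];
Strassen 1988, §2–3 [Strassen1988]; Zuiddam 2018, §2.3 [Zuiddam2018]. No `sorry`, no new axiom, no instance, no
notation, no definition.
-/

noncomputable section

set_option linter.dupNamespace false

open Finset Literature.Computability.AlgebraicComplexity
open Summit.MatrixMultiplication.MatrixMultiplication.Theorems.TetrahedronTensor
open Summit.MatrixMultiplication.MatrixMultiplication.Theorems.TetraDiagonal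
open Summit.MatrixMultiplication.MatrixMultiplication.Theses.TetrahedronCarving

namespace Summit.MatrixMultiplication.MatrixMultiplication.Theorems.EdgePencil

/-! ## §30 The calibration -/

section Calibration

variable (F : Type) [Field F]

/-- **ONE EDGE**: under `TROP(n,2)` (`n ≥ 3`) and `ω(K₄) > ψ`, every pair-rate of a `T(K₄)`-maximal point is at
least `(ω(K₄) − 4)/(1 − log_n 2)`. [cite: ChristandlVranaZuiddam2016, §1.2] -/
theorem pairRateAt_ge_of_trop_two {n : ℕ} (hn : 3 ≤ n)
    (hT : ∀ φ ∈ DTensorClass.asymptoticSpectrumDTensors F 2,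
      φ (DTensorClass.mk (sixTetra F n 2)) ≤ max (φ (DTensorClass.mk (sixTetra F n 1))) ((n : ℝ) ^ 4))
    (hE : ¬ omegaTetra F ≤ omegaRect F 2 1 2) {φ : DTensorClass F 4 → ℝ}
    (hφ : φ ∈ DTensorClass.asymptoticSpectrumDTensors F 2)
    (hφT : φ (DTensorClass.mk (tetra F n)) = (n : ℝ) ^ omegaTetra F) (v w : Fin 4) (hvw : v ≠ w) :
    (omegaTetra F - 4) / (1 - Real.logb n 2) ≤
      Real.logb 2 (φ (DTensorClass.mk (fun a : Fin 4 → Fin 2 => (ind (a v = a w) : F)))) := by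
  have hn2 : 2 ≤ n := by omega
  have hn1 : 1 ≤ n := by omega
  have hn0' : (0 : ℝ) < n := by exact_mod_cast (show 0 < n by omega)
  have hn1' : (1 : ℝ) < n := by exact_mod_cast (show 1 < n by omega)
  have hδ1 : Real.logb n 2 < 1 := by
    rw [← Real.logb_self_eq_one hn1']
    exact Real.logb_lt_logb hn1' two_pos (by exact_mod_cast (show 2 < n by omega))
  have h1δ : 0 < 1 - Real.logb n 2 := by linarith
  obtain ⟨φ', hφ', hT', hP'⟩ := exists_transport_pair F v w hvw hφ
  rw [← hP' 2]
  -- coordinates of the transported point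
  set p := Real.logb 2 (φ' (DTensorClass.mk (fun a : Fin 4 → Fin 2 => (ind (a 0 = a 1) : F)))) with hp
  set d := Real.logb 2 (φ' (DTensorClass.mk (sixTetra F 2 1))) with hd
  have hφ'T : φ' (DTensorClass.mk (tetra F n)) = (n : ℝ) ^ omegaTetra F := by rw [hT' n, hφT]
  have hpd : p + d = omegaTetra F := by
    have h := spectrum_tetra_eq_rpow hφ' hn1
    rw [logb_spectrum_tetra_two hφ', hφ'T] at h
    have h' := congrArg (Real.logb n) h
    rwa [Real.logb_rpow hn0' hn1'.ne', Real.logb_rpow hn0' hn1'.ne', eq_comm] at h'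
  rcases le_max_iff.1 (hT φ' hφ') with hbl | hle
  · -- blind at thickness 2: then `φ'` is a `T(K₄)`-maximal `01`-blind point and the leaf holds
    exfalso
    have hbl' : φ' (DTensorClass.mk (sixTetra F n 2)) = φ' (DTensorClass.mk (sixTetra F n 1)) :=
      le_antisymm hbl (spectrum_diamond_le_sixTetra (by norm_num) hφ')
    have hP1 : φ' (DTensorClass.mk (fun a : Fin 4 → Fin 2 => (ind (a 0 = a 1) : F))) = 1 :=
      (blind_iff_pair_eq_one F hn1 hn2 hφ').1 hbl'
    have hPn : φ' (DTensorClass.mk (fun a : Fin 4 → Fin n => (ind (a 0 = a 1) : F))) = 1 := by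
      rw [spectrum_pair_eq_rpow hφ' hn1, hP1, Real.logb_one, Real.rpow_zero]
    have hblind : φ' (DTensorClass.mk (tetra F n)) = φ' (DTensorClass.mk (sixTetra F n 1)) := by
      rw [← sixTetra_of_le (le_refl n)]
      exact (blind_iff_pair_eq_one F hn1 le_rfl hφ').2 hPn
    have hmax : φ' (DTensorClass.mk (tetra F n)) =
        asympRankOf (fun x y : DTensorClass F 4 => x ≤ y) (DTensorClass.mk (tetra F n)) := by
      rw [hφ'T, rpow_omegaTetra_eq_asympRank F hn2]
    exact hE ((excessZero_iff_exists_blind_maximal F hn2).2 ⟨φ', hφ', hmax, hblind⟩)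
  · -- below the flattening bound: `2^p · n^(ω - p) ≤ n^4`
    rw [spectrum_sixTetra_eq_rpow_mul_rpow (by norm_num) hn2 hφ'] at hle
    have hd' : d = omegaTetra F - p := by linarith
    have h2p : (0 : ℝ) < (2 : ℝ) ^ p := Real.rpow_pos_of_pos two_pos p
    have hnd : (0 : ℝ) < (n : ℝ) ^ d := Real.rpow_pos_of_pos hn0' d
    have hlog := Real.logb_le_logb_of_le hn1' (mul_pos h2p hnd) hle
    rw [Real.logb_mul h2p.ne' hnd.ne', Real.logb_rpow_eq_mul_logb_of_pos two_pos,
      Real.logb_rpow hn0' hn1'.ne', ← Real.rpow_natCast, Real.logb_rpow hn0' hn1'.ne', hd'] at hlog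
    rw [div_le_iff₀ h1δ]
    push_cast at hlog
    nlinarith [hlog]

/-- **THE CALIBRATION** `TROP(n,2) ⟹ ω(K₄) ≤ max(ψ, 24/(5 + log_n 2))` (`n ≥ 3`, every field). [cite: ChristandlVranaZuiddam2016, §1.2] -/
theorem omegaTetra_le_max_of_trop_two {n : ℕ} (hn : 3 ≤ n)
    (hT : ∀ φ ∈ DTensorClass.asymptoticSpectrumDTensors F 2,
      φ (DTensorClass.mk (sixTetra F n 2)) ≤ max (φ (DTensorClass.mk (sixTetra F n 1))) ((n : ℝ) ^ 4)) :
    omegaTetra F ≤ max (omegaRect F 2 1 2) (24 / (5 + Real.logb n 2)) := by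
  by_cases hE : omegaTetra F ≤ omegaRect F 2 1 2
  · exact le_max_of_le_left hE
  refine le_max_of_le_right ?_
  have hn2 : 2 ≤ n := by omega
  have hn1 : 1 ≤ n := by omega
  have hn0' : (0 : ℝ) < n := by exact_mod_cast (show 0 < n by omega)
  have hn1' : (1 : ℝ) < n := by exact_mod_cast (show 1 < n by omega)
  have hδ0 : 0 < Real.logb n 2 := Real.logb_pos hn1' one_lt_two
  have hδ1 : Real.logb n 2 < 1 := by
    rw [← Real.logb_self_eq_one hn1']
    exact Real.logb_lt_logb hn1' two_pos (by exact_mod_cast (show 2 < n by omega))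
  have h1δ : 0 < 1 - Real.logb n 2 := by linarith
  obtain ⟨φ, hφ, hφT⟩ := exists_spectrum_apply_tetra_eq_rpow_omegaTetra F hn2
  -- `τ_φ = ω(K₄)`
  have hτ : Real.logb 2 (φ (DTensorClass.mk (tetra F 2))) = omegaTetra F := by
    have h := spectrum_tetra_eq_rpow hφ hn1
    rw [hφT] at h
    have h' := congrArg (Real.logb n) h
    rwa [Real.logb_rpow hn0' hn1'.ne', Real.logb_rpow hn0' hn1'.ne', eq_comm] at h'
  -- the six pair-rates are all at least `(ω - 4)/(1 - δ)` and sum to `τ_φ = ω`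
  have hsum := logb_spectrum_tetra_two_eq_sum_pairs F hφ
  have h01 := pairRateAt_ge_of_trop_two F hn hT hE hφ hφT 0 1 (by decide)
  have h02 := pairRateAt_ge_of_trop_two F hn hT hE hφ hφT 0 2 (by decide)
  have h03 := pairRateAt_ge_of_trop_two F hn hT hE hφ hφT 0 3 (by decide)
  have h12 := pairRateAt_ge_of_trop_two F hn hT hE hφ hφT 1 2 (by decide)
  have h13 := pairRateAt_ge_of_trop_two F hn hT hE hφ hφT 1 3 (by decide)
  have h23 := pairRateAt_ge_of_trop_two F hn hT hE hφ hφT 2 3 (by decide)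
  have h6 : 6 * ((omegaTetra F - 4) / (1 - Real.logb n 2)) ≤ omegaTetra F := by linarith
  have h6' : 6 * (omegaTetra F - 4) ≤ omegaTetra F * (1 - Real.logb n 2) := by
    have h := mul_le_mul_of_nonneg_right h6 h1δ.le
    rwa [mul_assoc, div_mul_cancel₀ _ h1δ.ne'] at h
  rw [le_div_iff₀ (by linarith)]
  nlinarith [h6']

/-- **OVER `ℂ`, AGAINST THE ROUTE**: `TROP(n,2)` at one base `n ≥ 3` yields the leaf `TetraExcessZero` OR the cap
`ω(K₄) ≤ 24/(5 + log_n 2)` (`< 4.8`; `4.2619…` at `n = 3`). [cite: ChristandlVranaZuiddam2016, §1.2] -/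
theorem tetraExcessZero_or_omegaTetra_le_of_trop_two {n : ℕ} (hn : 3 ≤ n)
    (hT : ∀ φ ∈ DTensorClass.asymptoticSpectrumDTensors ℂ 2,
      φ (DTensorClass.mk (sixTetra ℂ n 2)) ≤ max (φ (DTensorClass.mk (sixTetra ℂ n 1))) ((n : ℝ) ^ 4)) :
    TetraExcessZero ∨ omegaTetra ℂ ≤ 24 / (5 + Real.logb n 2) := by
  rcases le_max_iff.1 (omegaTetra_le_max_of_trop_two ℂ hn hT) with h | h
  · exact Or.inl h
  · exact Or.inr h

/-- **CONTRAPOSITIVE FOR THE DISPROVER**: if the leaf fails and `ω(K₄) > 24/(5 + log_n 2)`, then `TROP(n,2)` fails,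
i.e. some `φ ∈ X₄(ℂ)` sees the doubled edge above both `φ[D_n]` and `n⁴`. [cite: ChristandlVranaZuiddam2016, §1.2] -/
theorem exists_not_trop_two_of_lt_omegaTetra {n : ℕ} (hn : 3 ≤ n) (hE : ¬ TetraExcessZero)
    (hω : 24 / (5 + Real.logb n 2) < omegaTetra ℂ) :
    ∃ φ ∈ DTensorClass.asymptoticSpectrumDTensors ℂ 2,
      max (φ (DTensorClass.mk (sixTetra ℂ n 1))) ((n : ℝ) ^ 4) < φ (DTensorClass.mk (sixTetra ℂ n 2)) := by
  by_contra h
  push Not at h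
  rcases tetraExcessZero_or_omegaTetra_le_of_trop_two hn h with h' | h'
  · exact hE h'
  · exact absurd hω (not_lt.2 h')

/-- **THE CAP IS BELOW `4.8`**: `24/(5 + log_n 2) < 24/5` for `n ≥ 2`. [folklore] -/
theorem cap_lt {n : ℕ} (hn : 2 ≤ n) : 24 / (5 + Real.logb n 2) < 24 / 5 := by
  have hn1' : (1 : ℝ) < n := by exact_mod_cast (show 1 < n by omega)
  have hδ0 : 0 < Real.logb n 2 := Real.logb_pos hn1' one_lt_two
  exact div_lt_div_of_pos_left (by norm_num) (by norm_num) (by linarith)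

end Calibration

end Summit.MatrixMultiplication.MatrixMultiplication.Theorems.EdgePencil

end
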